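import Literature.NumberTheory.EllipticCurves.ModFiveImageZywinaG9
import HarnessLib

set_option autoImplicit false

/-!
# Zywina's `G₉ ⊂ GL₂(𝔽₅)`: every element passes the membership test `inG9` and has order dividing `24`
# (so `5 ∤ #G₉`; kernel-checked by `decide` on the computable model `Quad`)

Topic `NumberTheory/EllipticCurves` (namespace `…EllipticCurves.Zywina2015G9`, as the statement file).  THEOREM-ONLY file (no
definition, no named fact, no `sorry`); literature seat `bsd-potss-conjA-anchor` g12 (supports stmt-BirchSwinnertonDyer-19413: the KT rows
with image `5S4 = G₉` at `p = 5`; closes nothing).  The statement file `ModFiveImageZywinaG9.lean` DEFINES `G9` as the subgroup of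
`GL₂(𝔽₅)` generated by Zywina's four printed matrices `(2 0; 0 1)`, `(1 0; 0 2)`, `(0 −1; 1 0)`, `(1 1; 1 −1)` and a computable model
`Quad` of `M₂(𝔽₅)` with the Boolean test `Quad.inG9` («`x`, `m₁x` or `m₂x` is monomial», `m₁ = (1 1; 1 4)`, `m₂ = (1 2; 1 3)`), proving
nothing about them.  Here (all by `decide` over the `625` quadruples, and a closure induction):

* §1 `Quad` bookkeeping (private helpers): `ofMatrix` is multiplicative, injective, takes powers to `npow`, and `det ∘ ofMatrix = Matrix.det`;
* §2 the finite facts: `inG9` is stable under left multiplication by the four generators and their inverses on invertible quadruples,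
  and every invertible quadruple passing `inG9` satisfies `x²⁴ = 1`;
* §3 `inG9_ofMatrix_of_mem_G9`: every `M ∈ G9` passes `inG9`; `coe_pow_twentyfour_eq_one_of_mem_G9`: `M²⁴ = 1`;
  `orderOf_dvd_twentyfour_of_mem_G9`.  (`#G₉ = 96 = 2⁵·3`, exponent `24`; consumer: the `μ = 0` bridge
  `IwasawaTheory/ClassicalMuVanishesZywinaG9FiveImage.lean`, which needs «no element of order `5`».)

References: [Zywina2015, §1.3 (G₉ and its generators; index 5)]; [Serre1972, §2.5–2.6 (the exceptional subgroups)].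
-/

namespace Literature.NumberTheory.EllipticCurves.Zywina2015G9

open Quad

/-! ### §1 `Quad` bookkeeping -/

/-- `ofMatrix` is multiplicative. [folklore] -/
private theorem Quad.ofMatrix_mul (A B : Matrix (Fin 2) (Fin 2) (ZMod 5)) : ofMatrix (A * B) = mul (ofMatrix A) (ofMatrix B) := by
  simp only [ofMatrix, mul, Matrix.mul_apply, Fin.sum_univ_two]

/-- `toMatrix ∘ ofMatrix = id`. [folklore] -/
private theorem Quad.toMatrix_ofMatrix (A : Matrix (Fin 2) (Fin 2) (ZMod 5)) : toMatrix (ofMatrix A) = A := by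
  simp only [toMatrix, ofMatrix]
  exact (Matrix.eta_fin_two A).symm

/-- `ofMatrix` is injective. [folklore] -/
private theorem Quad.ofMatrix_injective : Function.Injective ofMatrix := fun A B h => by
  rw [← toMatrix_ofMatrix A, h, toMatrix_ofMatrix]

/-- `ofMatrix 1 = one`. [folklore] -/
private theorem Quad.ofMatrix_one : ofMatrix (1 : Matrix (Fin 2) (Fin 2) (ZMod 5)) = one := by
  decide

/-- `ofMatrix (Aⁿ) = npow n (ofMatrix A)`. [folklore] -/
private theorem Quad.ofMatrix_pow (A : Matrix (Fin 2) (Fin 2) (ZMod 5)) (n : ℕ) : ofMatrix (A ^ n) = npow n (ofMatrix A) := by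
  induction n with
  | zero => rw [pow_zero, ofMatrix_one]; rfl
  | succ n ih => simp only [pow_succ, ofMatrix_mul, ih, npow, Function.iterate_succ_apply']

/-- `det (ofMatrix A) = A.det`. [folklore] -/
private theorem Quad.det_ofMatrix (A : Matrix (Fin 2) (Fin 2) (ZMod 5)) : det (ofMatrix A) = A.det := by
  rw [Matrix.det_fin_two]; rfl

/-- The quadruple of an invertible matrix has non-zero `det`. [folklore] -/
private theorem Quad.det_ofMatrix_coe_ne_zero (M : GL (Fin 2) (ZMod 5)) : det (ofMatrix (M : Matrix (Fin 2) (Fin 2) (ZMod 5))) ≠ 0 := by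
  haveI : Fact (1 < 5) := ⟨by norm_num⟩
  rw [det_ofMatrix]
  exact ((Matrix.isUnit_iff_isUnit_det _).mp (Units.isUnit M)).ne_zero

/-! ### §2 The finite facts (by `decide`) -/

/-- Left multiplication by the four generators `(2 0; 0 1)`, `(1 0; 0 2)`, `(0 4; 1 0)`, `(1 1; 1 4)` and by their inverses
`(3 0; 0 1)`, `(1 0; 0 3)`, `(0 1; 4 0)`, `(3 3; 3 2)` preserves `inG9` on invertible quadruples. [folklore] -/
private theorem inG9_mul_of_inG9 : ∀ g ∈ ([(2, 0, 0, 1), (1, 0, 0, 2), (0, 4, 1, 0), (1, 1, 1, 4),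
      (3, 0, 0, 1), (1, 0, 0, 3), (0, 1, 4, 0), (3, 3, 3, 2)] : List Quad),
    ∀ x : Quad, det x ≠ 0 → inG9 x = true → inG9 (mul g x) = true := by
  decide +kernel

/-- Every invertible quadruple passing `inG9` satisfies `x²⁴ = 1` (the exponent of `G₉` is `24`). [folklore] -/
private theorem npow_twentyfour_of_inG9 : ∀ x : Quad, det x ≠ 0 → inG9 x = true → npow 24 x = one := by
  decide +kernel

/-- The left inverse of the generator `(2 0; 0 1)` is `(3 0; 0 1)`. [folklore] -/
private theorem eq_inv_of_mul_generator₁ : ∀ q : Quad, mul q (2, 0, 0, 1) = one → q = (3, 0, 0, 1) := by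
  decide +kernel

/-- The left inverse of the generator `(1 0; 0 2)` is `(1 0; 0 3)`. [folklore] -/
private theorem eq_inv_of_mul_generator₂ : ∀ q : Quad, mul q (1, 0, 0, 2) = one → q = (1, 0, 0, 3) := by
  decide +kernel

/-- The left inverse of the generator `(0 4; 1 0)` is `(0 1; 4 0)`. [folklore] -/
private theorem eq_inv_of_mul_generator₃ : ∀ q : Quad, mul q (0, 4, 1, 0) = one → q = (0, 1, 4, 0) := by
  decide +kernel

/-- The left inverse of the generator `(1 1; 1 4)` is `(3 3; 3 2)`. [folklore] -/
private theorem eq_inv_of_mul_generator₄ : ∀ q : Quad, mul q (1, 1, 1, 4) = one → q = (3, 3, 3, 2) := by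
  decide +kernel

/-- `(0 −1; 1 0)` and `(1 1; 1 −1)` as quadruples with entries `4 = −1`. [folklore] -/
private theorem generatorQuads_eq : ∀ q : Quad, q ∈ generatorQuads ↔
    (q = (2, 0, 0, 1) ∨ q = (1, 0, 0, 2) ∨ q = (0, 4, 1, 0) ∨ q = (1, 1, 1, 4)) := by
  intro q
  simp only [generatorQuads, Set.mem_insert_iff, Set.mem_singleton_iff]
  have h4 : (-1 : ZMod 5) = 4 := by decide
  rw [h4]

/-! ### §3 Every element of `G₉` passes `inG9` and has order dividing `24` -/

/-- **Every element of Zywina's `G₉` passes the membership test `inG9`** (closure induction: `1` passes, and left multiplication by a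
generator or its inverse preserves the test on invertible matrices). [cite: Zywina2015, §1.3 (G₉ and its generators)] -/
theorem inG9_ofMatrix_of_mem_G9 {M : GL (Fin 2) (ZMod 5)} (hM : M ∈ G9) :
    inG9 (ofMatrix (M : Matrix (Fin 2) (Fin 2) (ZMod 5))) = true := by
  induction hM using Subgroup.closure_induction_left with
  | one => rw [Units.val_one, ofMatrix_one]; decide
  | mul_left x hx y hy ih =>
    rw [Units.val_mul, ofMatrix_mul]
    have hx' := (generatorQuads_eq _).mp hx
    have hy' := det_ofMatrix_coe_ne_zero y
    rcases hx' with h | h | h | h <;> rw [h]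
    · exact inG9_mul_of_inG9 _ (by simp) _ hy' ih
    · exact inG9_mul_of_inG9 _ (by simp) _ hy' ih
    · exact inG9_mul_of_inG9 _ (by simp) _ hy' ih
    · exact inG9_mul_of_inG9 _ (by simp) _ hy' ih
  | inv_mul_cancel x hx y hy ih =>
    rw [Units.val_mul, ofMatrix_mul]
    have hx' := (generatorQuads_eq _).mp hx
    have hy' := det_ofMatrix_coe_ne_zero y
    have hinv : mul (ofMatrix ((x⁻¹ : GL (Fin 2) (ZMod 5)) : Matrix (Fin 2) (Fin 2) (ZMod 5)))
        (ofMatrix ((x : GL (Fin 2) (ZMod 5)) : Matrix (Fin 2) (Fin 2) (ZMod 5))) = one := by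
      rw [← ofMatrix_mul, Units.inv_mul, ofMatrix_one]
    rcases hx' with h | h | h | h <;> rw [h] at hinv
    · rw [eq_inv_of_mul_generator₁ _ hinv]; exact inG9_mul_of_inG9 _ (by simp) _ hy' ih
    · rw [eq_inv_of_mul_generator₂ _ hinv]; exact inG9_mul_of_inG9 _ (by simp) _ hy' ih
    · rw [eq_inv_of_mul_generator₃ _ hinv]; exact inG9_mul_of_inG9 _ (by simp) _ hy' ih
    · rw [eq_inv_of_mul_generator₄ _ hinv]; exact inG9_mul_of_inG9 _ (by simp) _ hy' ih

/-- **Every element of `G₉` satisfies `M²⁴ = 1`** (`#G₉ = 96`, exponent `24`). [cite: Zywina2015, §1.3 (G₉; index 5 in GL₂(𝔽₅))] -/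
theorem coe_pow_twentyfour_eq_one_of_mem_G9 {M : GL (Fin 2) (ZMod 5)} (hM : M ∈ G9) :
    (M : Matrix (Fin 2) (Fin 2) (ZMod 5)) ^ 24 = 1 := by
  apply ofMatrix_injective
  rw [ofMatrix_pow, ofMatrix_one]
  exact npow_twentyfour_of_inG9 _ (det_ofMatrix_coe_ne_zero M) (inG9_ofMatrix_of_mem_G9 hM)

/-- Every element of `G₉` has order dividing `24`; in particular `G₉` has no element of order `5`. [cite: Zywina2015, §1.3] -/
theorem orderOf_dvd_twentyfour_of_mem_G9 {M : GL (Fin 2) (ZMod 5)} (hM : M ∈ G9) : orderOf M ∣ 24 := by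
  apply orderOf_dvd_of_pow_eq_one
  apply Units.ext
  rw [Units.val_pow_eq_pow_val, Units.val_one]
  exact coe_pow_twentyfour_eq_one_of_mem_G9 hM

end Literature.NumberTheory.EllipticCurves.Zywina2015G9
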